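import Summits.QuantumFields.YangMills.Theorems.UnitScaleTiltProp7TrueAvgBudgetOfRLegs
import Summits.QuantumFields.YangMills.Theorems.UnitScaleTiltProp7RLegsCovKnitB
import HarnessLib

/-!
# Route `UnitScaleTilt`, crux K1 «MinimiserStabilityRegPr» (stmt-QuantumFields-19200), stub `stub_existenceMinimalOrbit` (EX), LANE II (B4★)∕(QB) —
# ★★★ THE E′ ENGINE ROW `hEng` AND THE ROW (QB) FROM ★routeR's TWO LINEAR-RESPONSE ROWS (hG) ∕ (hN′) OF THE COMB SINGLE-BAR LINEAR TOWER:
# `hEng_of_linTower_rows (hG) (hN′) : ⟨hEng = SKELETON v1.2 :94 VERBATIM⟩`, `hQB_of_linTower_rows (hG) (hN′) : ⟨hQB VERBATIM⟩`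

Cell `ym3-torus` (HUMAN RULING D-0037, YM ladder rung R3 — YM₃ on T³ is a rung, NOT d = 4, NOT infinite volume, NOT a mass gap, NOT Clay; the YM gap is NOT proved),
width seat `ym3-torus-px19` (gen 7; the lineage's (QB) pen).  THEOREMS ONLY (0 `def`, 0 `sorry`); `--supports stmt-QuantumFields-19200 --as helper`, count-neutral; nothing
here claims the stub, the crux or any summit statement.

THE CHAIN, ALL BY NAME.  ★routeR's rows (hG) (gradient energy) ∕ (hN′) (mass) of the linear response `Y_l = D[Ũˡ(W♯,(eᵗ)♯)]·A` of the comb single-bar tower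
([Balaban1985Averaging] (89)–(92), (97), (160); texts = w4-20520 g12's SIGNATURE-0 v2, ★routeR-w2 g10's (hN′) re-cut)
  ⟹ (R-LEGS) — w4-20520 ✓`Prop7RLegsCovKnitB.rlegs_of_linTower_rowsB` (K2′, the `ℓ⁻²`-anchored rows (hG♭)∕(hN♭)) (the curved corner-frame legs of the comb chart, [Balaban1985Averaging] (125)–(127))
  ⟹ (QB) — px19 ✓`Prop7TrueAvgBudgetOfRLegs.hQB_of_rlegs` («true average ≤ twisted average + legs», [Balaban1985BackgroundPropagators] (3.13)–(3.15))
  ⟹ (ENG) = `hEng` — px19 g6 ✓`Prop7EngOfTrueAvgBudget.hEng_of_trueAvgBudget` (the linearised-subspace core budget of [Balaban1985BackgroundPropagators] Thm 3.11 at the member).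
So the lane-II door's `hEng` slot reads «⟸ (hG) ∧ (hN′)» by ONE name each.

WHAT IS PROVED (ns `…Theorems.Prop7EngOfLinTowerRows`): ★★★`hEng_of_linTower_rows`, ★★`hQB_of_linTower_rows` (both `exact` compositions).
HONEST SCOPE.  (hG)∕(hN′) are NOT proved here (★routeR's (II) lane: the sourceless∕derivative reading F-8′ of the F-8 cell theorem); nothing of (REC), `hN06`, EX or the crux;
nothing continuum ∕ OS ∕ mass-gap ∕ Clay.

References: T. Bałaban, CMP **98** (1985) 17–51 [Balaban1985Averaging] ((89)–(92) p.31, (97) p.32, (125)–(127) pp.36–37, (160) p.42); CMP **99** (1985) 389–434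
[Balaban1985BackgroundPropagators] ((3.13) p.392, (3.14)–(3.15) p.393, Thm 3.11 p.416); CMP **102** (1985) 277–309 [Balaban1985Variational] ((14) p.280, (44) p.285).
-/

set_option autoImplicit false

noncomputable section

open scoped BigOperators Matrix.Norms.L2Operator Matrix InnerProductSpace

namespace Summit.QuantumFields.YangMills.Theorems.Prop7EngOfLinTowerRows

open Literature.MathematicalPhysics.QuantumFieldTheory.Balaban1983to89
open Literature.MathematicalPhysics.QuantumFieldTheory.Balaban1983to89.T3ContinuumYM3Torus
open Literature.MathematicalPhysics.QuantumFieldTheory.Balaban1983to89.T3PrintedRegularMinimiser (RegPr)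
open Finset T4Continuum BlockAveraging AveragingRT ExpMeanLog BlockAveragingEMLLinearised BlockAveragingEMLLinearisedBackground
open T3LevelShift (bondShift)
open T3PrintedRegularOrbits (sites_eq)
open T3SectALandauChart (bgUnits)
open B7Prop1Explicit (expUnit)
open B7Prop2Explicit (avgIter)
open B7Eq92Concrete (tildIter)
open B7Eq78Linearization (conjR)
open B10Eq27TorusAxialLog (pull unitsField toUField)
open B9Eq39Adjoint (curl divB)
open B9TorusCalculus (torusT)
open B11Eq103H1Complex (BondL2K)
open Summit.QuantumFields.YangMills.Theorems.Prop7SPrint (basePt)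
open Summit.QuantumFields.YangMills.Theorems.Prop7SectET3Transport (periodsT3)
open Summit.QuantumFields.YangMills.Theorems.Prop7SectET3HilbertLetters (W₂ frobEquiv DstarL2)
open Summit.QuantumFields.YangMills.Theorems.Prop7SectET3WilsonHessian (DeltaEtaSlot)
open Summit.QuantumFields.YangMills.Theorems.Prop7SectET3CombLetters (Qkc)
open Summit.QuantumFields.YangMills.Theorems.Prop7SymAvgTw (frameTw QTw)
open Summit.QuantumFields.YangMills.Theorems.Prop7RLegsCovKnitB (rlegs_of_linTower_rowsB)
open Summit.QuantumFields.YangMills.Theorems.Prop7TrueAvgBudgetOfRLegs (hQB_of_rlegs hEng_of_rlegs)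

/-- ★★ **(QB) FROM ★routeR's LINEAR-RESPONSE ROWS (hG) ∕ (hN′)** — ✓`hQB_of_rlegs` ∘ w4-20520 ✓`rlegs_of_linTower_rowsB` (K2′: rows with the third slot `e²·Lˡ·ℓ⁻²·SA`).
[cite: Balaban1985Averaging, (89)-(92) p.31, (125)-(127) pp.36-37, (160) p.42; Balaban1985BackgroundPropagators, (3.13) p.392, (3.14)-(3.15) p.393] -/
theorem hQB_of_linTower_rowsB
    (hG : ∀ (L : ℕ), 1 < L → ∃ CG CG' eG : ℝ, 0 ≤ CG ∧ 0 ≤ CG' ∧ 0 < eG ∧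
      ∀ (F : T3Family), F.L = L → ∀ (n K : ℕ) (hnK : n < K) (e : ℝ) (W : GaugeField (F.P K) 0 (Matrix.specialUnitaryGroup (Fin 2) ℂ)),
        0 < e → e ≤ eG → RegPr F n K e W → ∀ (A : PBond (F.P K) 0 → Matrix (Fin 2) (Fin 2) ℂ) (l : ℕ), l < K - n → ∀ μ : Fin (F.P K).d,
        ∑ x : Site (F.P K) l, ∑ κ : Fin (F.P K).d,
          ‖fderiv ℂ (fun t : PBond (F.P K) 0 → Matrix (Fin 2) (Fin 2) ℂ =>
                ((tildIter (F.P K).L (pull (bgUnits F K W) (basePt F n K)) (pull (fun b => expUnit (t b)) (basePt F n K)) l (fun ν => ((x ν).val : ℤ)) κ :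
                  (Matrix (Fin 2) (Fin 2) ℂ)ˣ) : Matrix (Fin 2) (Fin 2) ℂ)) 0 A
            - conjR (avgIter (F.P K).L (pull (bgUnits F K W) (basePt F n K)) l (fun ν => ((x ν).val : ℤ)) μ)
              (fderiv ℂ (fun t : PBond (F.P K) 0 → Matrix (Fin 2) (Fin 2) ℂ =>
                ((tildIter (F.P K).L (pull (bgUnits F K W) (basePt F n K)) (pull (fun b => expUnit (t b)) (basePt F n K)) l ((fun ν => ((x ν).val : ℤ)) + B7Prop1Explicit.e μ) κ :
                  (Matrix (Fin 2) (Fin 2) ℂ)ˣ) : Matrix (Fin 2) (Fin 2) ℂ)) 0 A)‖ ^ 2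
          ≤ CG * (F.L : ℝ) ^ l * (∑ b : PBond (F.P K) 0, ∑ ν : Fin (F.P K).d,
                ‖((W ⟨b.src, ν⟩ : Matrix.specialUnitaryGroup (Fin 2) ℂ) : Matrix (Fin 2) (Fin 2) ℂ) * A ⟨b.src.shift ν, b.dir⟩
                    * star ((W ⟨b.src, ν⟩ : Matrix.specialUnitaryGroup (Fin 2) ℂ) : Matrix (Fin 2) (Fin 2) ℂ) - A b‖ ^ 2)
            + CG' * e ^ 2 * (F.L : ℝ) ^ l * (((F.L : ℝ) ^ (K - n)) ^ 2)⁻¹ * ∑ b : PBond (F.P K) 0, ‖A b‖ ^ 2)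
    (hN : ∀ (L : ℕ), 1 < L → ∃ CN CN' CN'' eN : ℝ, 0 ≤ CN ∧ 0 ≤ CN' ∧ 0 ≤ CN'' ∧ 0 < eN ∧
      ∀ (F : T3Family), F.L = L → ∀ (n K : ℕ) (hnK : n < K) (e : ℝ) (W : GaugeField (F.P K) 0 (Matrix.specialUnitaryGroup (Fin 2) ℂ)),
        0 < e → e ≤ eN → RegPr F n K e W → ∀ (A : PBond (F.P K) 0 → Matrix (Fin 2) (Fin 2) ℂ) (l : ℕ), l < K - n →
        ∑ x : Site (F.P K) l, ∑ κ : Fin (F.P K).d,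
          ‖fderiv ℂ (fun t : PBond (F.P K) 0 → Matrix (Fin 2) (Fin 2) ℂ =>
                ((tildIter (F.P K).L (pull (bgUnits F K W) (basePt F n K)) (pull (fun b => expUnit (t b)) (basePt F n K)) l (fun ν => ((x ν).val : ℤ)) κ :
                  (Matrix (Fin 2) (Fin 2) ℂ)ˣ) : Matrix (Fin 2) (Fin 2) ℂ)) 0 A‖ ^ 2
          ≤ CN * ((F.L : ℝ) ^ l)⁻¹ * ∑ b : PBond (F.P K) 0, ‖A b‖ ^ 2
            + CN' * (F.L : ℝ) ^ l * (∑ b : PBond (F.P K) 0, ∑ ν : Fin (F.P K).d,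
                ‖((W ⟨b.src, ν⟩ : Matrix.specialUnitaryGroup (Fin 2) ℂ) : Matrix (Fin 2) (Fin 2) ℂ) * A ⟨b.src.shift ν, b.dir⟩
                    * star ((W ⟨b.src, ν⟩ : Matrix.specialUnitaryGroup (Fin 2) ℂ) : Matrix (Fin 2) (Fin 2) ℂ) - A b‖ ^ 2)
            + CN'' * e ^ 2 * (F.L : ℝ) ^ l * (((F.L : ℝ) ^ (K - n)) ^ 2)⁻¹ * ∑ b : PBond (F.P K) 0, ‖A b‖ ^ 2) :
    ∀ (L : ℕ), 1 < L → ∃ Cq Cq' eq : ℝ, 0 ≤ Cq ∧ 0 ≤ Cq' ∧ 0 < eq ∧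
      ∀ (F : T3Family), F.L = L → ∀ (n K : ℕ) (hnK : n < K) (e : ℝ) (W : GaugeField (F.P K) 0 (Matrix.specialUnitaryGroup (Fin 2) ℂ)),
        0 < e → e ≤ eq → RegPr F n K e W →
        ∀ (Q : (k : ℕ) → (PBond (F.P K) 0 → Matrix (Fin 2) (Fin 2) ℂ) → PBond (F.P K) k → Matrix (Fin 2) (Fin 2) ℂ), (∀ Y, Q 0 Y = Y) →
        (∀ (k : ℕ) (Y : PBond (F.P K) 0 → Matrix (Fin 2) (Fin 2) ℂ) (c : PBond (F.P K) (k + 1)), Q (k + 1) Y c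
          = (fderiv ℂ (eml : (Idx (F.P K) → Matrix (Fin 2) (Fin 2) ℂ) → Matrix (Fin 2) (Fin 2) ℂ)
                (fun i => ((loopHol (Averaging.iter (fun i => blockAvg (P := (F.P K)) (j := i) (expMeanLogSU (n := Fin 2))) k W) c i : Matrix.specialUnitaryGroup (Fin 2) ℂ) : Matrix (Fin 2) (Fin 2) ℂ))
                (fun i => covWalkSum (Averaging.iter (fun i => blockAvg (P := (F.P K)) (j := i) (expMeanLogSU (n := Fin 2))) k W) (Q k Y) (walk (emb c.src) (loopWord (F.P K).L c.dir (off i.1) i.2.1 i.2.2))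
                  * ((loopHol (Averaging.iter (fun i => blockAvg (P := (F.P K)) (j := i) (expMeanLogSU (n := Fin 2))) k W) c i : Matrix.specialUnitaryGroup (Fin 2) ℂ) : Matrix (Fin 2) (Fin 2) ℂ))
                * star ((corr (expMeanLogSU (n := Fin 2)) (Averaging.iter (fun i => blockAvg (P := (F.P K)) (j := i) (expMeanLogSU (n := Fin 2))) k W) c : Matrix.specialUnitaryGroup (Fin 2) ℂ) : Matrix (Fin 2) (Fin 2) ℂ)
              + ((corr (expMeanLogSU (n := Fin 2)) (Averaging.iter (fun i => blockAvg (P := (F.P K)) (j := i) (expMeanLogSU (n := Fin 2))) k W) c : Matrix.specialUnitaryGroup (Fin 2) ℂ) : Matrix (Fin 2) (Fin 2) ℂ)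
                * covWalkSum (Averaging.iter (fun i => blockAvg (P := (F.P K)) (j := i) (expMeanLogSU (n := Fin 2))) k W) (Q k Y) (walk (emb c.src) (List.replicate (F.P K).L (c.dir, true)))
                * star ((corr (expMeanLogSU (n := Fin 2)) (Averaging.iter (fun i => blockAvg (P := (F.P K)) (j := i) (expMeanLogSU (n := Fin 2))) k W) c : Matrix.specialUnitaryGroup (Fin 2) ℂ) : Matrix (Fin 2) (Fin 2) ℂ))) →
        ∀ (A : PBond (F.P K) 0 → Matrix (Fin 2) (Fin 2) ℂ),
          ∑ c : PBond (F.P K) (K - n), ‖Q (K - n) A c‖ ^ 2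
            ≤ 2 * (∑ c : PBond (F.P n) 0, ‖(frobEquiv.symm (QTw F n K hnK.le W A c) : W₂)‖ ^ 2)
              + Cq * (F.L : ℝ) ^ (K - n) * ((∑ x : Site (F.P K) 0, ∑ μ : Fin (F.P K).d, ∑ ν : Fin (F.P K).d,
                    (if μ < ν then ∑ j : Fin 2, ∑ k : Fin 2,
                      ‖(curl (torusT (F.P K) 0) (fun κ z => unitsField (toUField W) ⟨z, κ⟩) (fun κ z => A ⟨z, κ⟩) μ ν x) j k‖ ^ 2 else 0))
                  + (∑ x : Site (F.P K) 0, ∑ j : Fin 2, ∑ k : Fin 2,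
                    ‖(divB (torusT (F.P K) 0) (fun κ z => unitsField (toUField W) ⟨z, κ⟩) (fun κ z => A ⟨z, κ⟩) x) j k‖ ^ 2))
              + Cq' * e * ((F.L : ℝ) ^ (K - n))⁻¹ * (∑ b : PBond (F.P K) 0, ‖A b‖ ^ 2) :=
  hQB_of_rlegs (rlegs_of_linTower_rowsB hG hN)

/-- ★★★ **THE E′ ENGINE ROW `hEng` FROM ★routeR's LINEAR-RESPONSE ROWS (hG) ∕ (hN′)** — ✓`hEng_of_rlegs` ∘ w4-20520 ✓`rlegs_of_linTower_rowsB` (K2′): the displayed `hEng` of the lane-II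
door ✓`Prop7HcoOfDivRecovery.hN06_of_divRecovery` (= ✓p702330's binder, SKELETON v1.2 :94) now hinges on (hG) ∧ (hN′) alone.
[cite: Balaban1985BackgroundPropagators, Thm 3.11 p.416, (3.13) p.392, (3.14)-(3.15) p.393; Balaban1985Averaging, (89)-(92) p.31, (160) p.42; Balaban1985Variational, (14) p.280, (44) p.285] -/
theorem hEng_of_linTower_rowsB (c₀ cB a₀ : ℕ → ℝ) [∀ L : ℕ, Fact (0 < c₀ L)] [∀ L : ℕ, Fact (0 < cB L)]
    (ha₀ : ∀ L : ℕ, 1 < L → 0 < a₀ L)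
    (hG : ∀ (L : ℕ), 1 < L → ∃ CG CG' eG : ℝ, 0 ≤ CG ∧ 0 ≤ CG' ∧ 0 < eG ∧
      ∀ (F : T3Family), F.L = L → ∀ (n K : ℕ) (hnK : n < K) (e : ℝ) (W : GaugeField (F.P K) 0 (Matrix.specialUnitaryGroup (Fin 2) ℂ)),
        0 < e → e ≤ eG → RegPr F n K e W → ∀ (A : PBond (F.P K) 0 → Matrix (Fin 2) (Fin 2) ℂ) (l : ℕ), l < K - n → ∀ μ : Fin (F.P K).d,
        ∑ x : Site (F.P K) l, ∑ κ : Fin (F.P K).d,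
          ‖fderiv ℂ (fun t : PBond (F.P K) 0 → Matrix (Fin 2) (Fin 2) ℂ =>
                ((tildIter (F.P K).L (pull (bgUnits F K W) (basePt F n K)) (pull (fun b => expUnit (t b)) (basePt F n K)) l (fun ν => ((x ν).val : ℤ)) κ :
                  (Matrix (Fin 2) (Fin 2) ℂ)ˣ) : Matrix (Fin 2) (Fin 2) ℂ)) 0 A
            - conjR (avgIter (F.P K).L (pull (bgUnits F K W) (basePt F n K)) l (fun ν => ((x ν).val : ℤ)) μ)
              (fderiv ℂ (fun t : PBond (F.P K) 0 → Matrix (Fin 2) (Fin 2) ℂ =>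
                ((tildIter (F.P K).L (pull (bgUnits F K W) (basePt F n K)) (pull (fun b => expUnit (t b)) (basePt F n K)) l ((fun ν => ((x ν).val : ℤ)) + B7Prop1Explicit.e μ) κ :
                  (Matrix (Fin 2) (Fin 2) ℂ)ˣ) : Matrix (Fin 2) (Fin 2) ℂ)) 0 A)‖ ^ 2
          ≤ CG * (F.L : ℝ) ^ l * (∑ b : PBond (F.P K) 0, ∑ ν : Fin (F.P K).d,
                ‖((W ⟨b.src, ν⟩ : Matrix.specialUnitaryGroup (Fin 2) ℂ) : Matrix (Fin 2) (Fin 2) ℂ) * A ⟨b.src.shift ν, b.dir⟩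
                    * star ((W ⟨b.src, ν⟩ : Matrix.specialUnitaryGroup (Fin 2) ℂ) : Matrix (Fin 2) (Fin 2) ℂ) - A b‖ ^ 2)
            + CG' * e ^ 2 * (F.L : ℝ) ^ l * (((F.L : ℝ) ^ (K - n)) ^ 2)⁻¹ * ∑ b : PBond (F.P K) 0, ‖A b‖ ^ 2)
    (hN : ∀ (L : ℕ), 1 < L → ∃ CN CN' CN'' eN : ℝ, 0 ≤ CN ∧ 0 ≤ CN' ∧ 0 ≤ CN'' ∧ 0 < eN ∧
      ∀ (F : T3Family), F.L = L → ∀ (n K : ℕ) (hnK : n < K) (e : ℝ) (W : GaugeField (F.P K) 0 (Matrix.specialUnitaryGroup (Fin 2) ℂ)),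
        0 < e → e ≤ eN → RegPr F n K e W → ∀ (A : PBond (F.P K) 0 → Matrix (Fin 2) (Fin 2) ℂ) (l : ℕ), l < K - n →
        ∑ x : Site (F.P K) l, ∑ κ : Fin (F.P K).d,
          ‖fderiv ℂ (fun t : PBond (F.P K) 0 → Matrix (Fin 2) (Fin 2) ℂ =>
                ((tildIter (F.P K).L (pull (bgUnits F K W) (basePt F n K)) (pull (fun b => expUnit (t b)) (basePt F n K)) l (fun ν => ((x ν).val : ℤ)) κ :
                  (Matrix (Fin 2) (Fin 2) ℂ)ˣ) : Matrix (Fin 2) (Fin 2) ℂ)) 0 A‖ ^ 2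
          ≤ CN * ((F.L : ℝ) ^ l)⁻¹ * ∑ b : PBond (F.P K) 0, ‖A b‖ ^ 2
            + CN' * (F.L : ℝ) ^ l * (∑ b : PBond (F.P K) 0, ∑ ν : Fin (F.P K).d,
                ‖((W ⟨b.src, ν⟩ : Matrix.specialUnitaryGroup (Fin 2) ℂ) : Matrix (Fin 2) (Fin 2) ℂ) * A ⟨b.src.shift ν, b.dir⟩
                    * star ((W ⟨b.src, ν⟩ : Matrix.specialUnitaryGroup (Fin 2) ℂ) : Matrix (Fin 2) (Fin 2) ℂ) - A b‖ ^ 2)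
            + CN'' * e ^ 2 * (F.L : ℝ) ^ l * (((F.L : ℝ) ^ (K - n)) ^ 2)⁻¹ * ∑ b : PBond (F.P K) 0, ‖A b‖ ^ 2) :
    ∀ (L : ℕ), 1 < L → ∃ γE κD κQ θE eE : ℝ, 0 < γE ∧ 0 ≤ κD ∧ 0 ≤ κQ ∧ 0 ≤ θE ∧ 0 < eE ∧
      ∀ (F : T3Family), F.L = L → ∀ (n K : ℕ) (hnK : n < K) (e : ℝ) (W : GaugeField (F.P K) 0 (Matrix.specialUnitaryGroup (Fin 2) ℂ)),
        0 < e → e ≤ eE → RegPr F n K e W →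
        ∀ y : BondL2K ℂ 3 (periodsT3 F K) (c₀ F.L) W₂,
          γE * ‖y‖ ^ 2 ≤ RCLike.re ⟪y, DeltaEtaSlot F n K (c₀ F.L) W y⟫_ℂ + κD * ‖DstarL2 F n K (c₀ F.L) W y‖ ^ 2
            + κQ * ((a₀ F.L * (c₀ F.L / cB F.L) * ((F.L : ℝ) ^ (K - n)) ^ 3) * ‖Qkc F n K hnK.le (c₀ F.L) (cB F.L) W y‖ ^ 2) + θE * e * ‖y‖ ^ 2 :=
  hEng_of_rlegs c₀ cB a₀ ha₀ (rlegs_of_linTower_rowsB hG hN)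

end Summit.QuantumFields.YangMills.Theorems.Prop7EngOfLinTowerRows

end
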